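import Literature.MathematicalPhysics.QuantumFieldTheory.Balaban1983to89.B8Prop6CubeMemberGaugedRealGamma
import Literature.MathematicalPhysics.QuantumFieldTheory.Balaban1983to89.B8Prop6DentedCubeMemberNormsFlatGamma
import Literature.MathematicalPhysics.QuantumFieldTheory.Balaban1983to89.B8Prop6DentedCubeMemberFlatScalarGamma
import Literature.MathematicalPhysics.QuantumFieldTheory.Balaban1983to89.B8Prop6DentedCubeMemberGauged

/-!
# `Balaban1983to89.B8Prop6DentedCubeMemberGaugedRealGamma` — [Balaban1985RegularSpaces] PROPOSITION 6 (p. 99), (1.135)–(1.138) ∕ [Balaban1985Variational] (152)–(153) AS NODE 00's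
# `GaugedBoundB8D` AT EVERY DENTED CUBE, FROM THE FLAT FOUR-LINE PROP.-3-FRAME γ SOCKET, THE THREE REAL INEQUALITY FAMILIES AND THEOREM 4's (1.59) CLAUSE AT BACKGROUND `1`
# — EDITION γ, dented twin of Fγ6 `B8Prop6CubeMemberGaugedRealGamma` §1 ((d3) MAP item (7))

statement-level skeleton of published theorems with citation tags; proofs where landed; nothing here is a claim about the
Yang–Mills mass gap

`[Balaban1985RegularSpaces]` ("B8" = [6], CMP **99** (1985) 75–102) Prop. 6 (1.135)–(1.138) p. 99, Thm 4 p. 88, Prop. 3 p. 87, Prop. 5 pp. 93–94, (1.58)–(1.62) pp. 86–87, (1.31) p. 82;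
`[Balaban1985Variational]` ("[15]", CMP **102** (1985) 277–309) (148)–(153) p. 301; [4] = `[Balaban1985BackgroundPropagators]` Thms 3.1–3.3 pp. 397–399; [B6] = `[Balaban1984PropagatorsII]`
(2.3) p. 224.  PDF held: `paper:balaban1985-cmp99-regular-spaces-gauge-fixing`, `paper:balaban1985-cmp102-variational-background`.

CITATION HEADER (lean-in-tree rule).  Cell `pub-ymgap` (HUMAN RULING D-0062, Track A), DAG node N05 = [B8], seat `pub-ymgap-dag-n05-e` (g31; row s3b, the (β) road; dag-n05-c standing GO
on dented twins I.42366).  WHY THIS FILE.  Fγ6 §1 composes Fγ5 (existence half from the REAL families + `H59D₁`), Fγ3 (the norm members from the flat socket) and the assembly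
`gaugedBoundB8_of_clauses` into `Node00.GaugedBoundB8` at every PURE cube.  THIS FILE is the same composition at the DENTED member: Fγ5-dented `prop6_dentedMember_flat_of_real_γ`
(p664305), Fγ3-dented `norms136_dentedMember_flat_γ_d4`, and `gaugedBoundB8D_of_clauses` (the (1.137) clause on the `Ω_k`-bonds only) ⇒ `Node00.GaugedBoundB8D` (p655171) — the
conclusion the N07 dented door (dag-n07-e) keys on.  §2 of the pure file (the family form over `zdCub`) has no dented analogue (the dented cubes are indexed by the record's cover,
dag-n07-e's side) and is not twinned.

WHAT THIS MODULE PROVES (kernel, 0 sorry; `c : Node00.CubeB8D d L K Ω`; `𝔸` a non-trivial C⋆-algebra): ★★ `gaugedBoundB8D_dentedMember_real_γ` — Fγ6's `gaugedBoundB8_cubeMember_real_γ`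
with `CubeB8 ↦ CubeB8D`, `cubeFam false … ↦ c.sq`, `cubeLamS … n ↦ c.lamST n` (`c.lamS` at the top), `cubeLamBP' ↦ c.lamBPT`, `GaugedBoundB8 ↦ GaugedBoundB8D`: ONE threshold
`c₁ > 0`; for every dented cube `c` on which the flat four-line γ socket holds (background `1`, index `c.lamBPT c.k ∪ CrossB (c.sq 0)`), every unitary `U₀ ∈ 𝔄_K({Ω_j}, α₀)` with
`7dL²Mα₀ ≤ c₁`, the weights, the three REAL families at every truncation of the dented member and `H59D₁` there: `GaugedBoundB8D L η U₀ c (7dL²·5dLB₀·Mα₀)`.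
HONEST SCOPE ∕ A6.  CONDITIONAL on the displayed inputs at the dented member (their servers: the named facts road — `Ineq159FlatDentedCubeMemberPrinted` p659892, the REAL families at
the top truncation, `GBoundDentedCubeMemberPrinted` p661669); nothing of [4]∕[6]∕[15] asserted; `≤` for print's `<`; `ℤᵈ` carriers.  Count-neutral; N05 ∕ N07 NOT discharged; one
finite `𝕋⁴` programme at fixed `ε`, Bałaban as printed; nothing continuum ∕ ℝ⁴ ∕ OS ∕ mass-gap ∕ Clay.  No `sorry`, no `def`, no `instance`, no `notation`.  Unit `pub-ymgap-dag-n05-e`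
(g31), 2026-08-28.
-/

noncomputable section

open NormedSpace

namespace Literature.MathematicalPhysics.QuantumFieldTheory.Balaban1983to89.B8Prop6DentedCubeMemberGaugedRealGamma

open scoped Matrix
open MatrixLog B7Prop1Explicit B7Prop2Explicit B7Prop1Local B7Eq92Concrete
open B7Prop4GeneralLevels (linCovIter)
open B8Ineq132 (covDerivFwd InAk BondTouches)
open B8Ineq133 (cutFixed)
open B8Lemma1NonAbelian (mulCfg)
open B8Eq119TwistedAxial (Restr129)
open B8Eq140Level (SideTouches)
open B8Eq143PlaqExpansion (pdiv)
open B8Eq146AExpansion (iEta plaqCovDeriv)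
open B8Eq155JBound (Jcur wsup)
open B8ScaledSupNorm (bondNorm msup)
open B8Eq184Proof (cfgExp)
open B8Eq138LandauZd (IsLandau138W covLap)
open B8LambdaSpaceKLevel (wt)
open B8Eq131Cubes (tLo tHi ctr)
open B8Eq131CubesAdmissible (cubeFam)
open B8CubeMemberZd (cubeLamS)
open B8Prop6OfThm4 (const_136 smallness_134)
open B8Prop6CubeMemberNormsAt (windows136_of_small)
open B8Prop6DentedCubeMemberNormsFlatGamma (norms136_dentedMember_flat_γ_d4)
open B8Prop6DentedCubeMemberFlatScalarGamma (prop6_dentedMember_flat_of_real_γ)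
open B9SupplySockB9P3ZdBeta (CrossB)
open B8Prop6DentedCubeMemberGauged (gaugedBoundB8D_of_clauses)
open Node00 (CubeB8D GaugedBoundB8D)
open Literature.MathematicalPhysics.QuantumLattice (blockMap)

export B7Prop1Explicit (Site)

variable {d : ℕ}

variable {𝔸 : Type} [CStarAlgebra 𝔸] [Nontrivial 𝔸]

/-! ## §1 `GaugedBoundB8` at every cube from the flat bodies in the repaired currency -/

open Classical in
/-- ★★ **PROPOSITION 6 (p. 99), (1.135)–(1.138) AS `Node00.GaugedBoundB8` AT EVERY DENTED CUBE ([15] (148)–(150)), FROM THE FLAT FOUR-LINE PROP.-3-FRAME γ SOCKET, THREE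
REAL INEQUALITY FAMILIES AND THEOREM 4's (1.59) CLAUSE `H59Dβ₁` AT BACKGROUND `1`** — p531701's `gaugedBoundB8_cubeMember_real_bdry` with both (1.59) inputs in EDITION γ
(averaging datum `|B₁|` over the split print class `cubeLamBP'` ∪ {level-0 crossing bonds of `□₀`} (inner AND crossing bonds at every level); per cube the bodies of dag-n06-b's `SockB9P3D4β` at the flat data); the three REAL
families VERBATIM; served by `B8Prop6CubeMemberNormsFlatGamma.norms136_cubeMember_flat_γ_d4` and `B8Prop6CubeMemberFlatScalarGamma.prop6_cubeMember_flat_of_real_γ`;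
proof verbatim. [cite: Balaban1985RegularSpaces, Prop. 6 (1.135)–(1.138) p.99, Thm 4 p.88, Prop. 3 p.87, Prop. 5 pp.93–94, (1.58)–(1.59) p.86, (1.31) p.82; Balaban1985BackgroundPropagators, Thms 3.1–3.3 pp.397–399] -/
theorem gaugedBoundB8D_dentedMember_real_γ (hd2 : 2 ≤ d) {L : ℕ} (hL : 2 ≤ L) {B₀ B₀' C₂ cB9 B₀'H B₂' BG BR Bbd : ℝ} (hB₀ : 0 < B₀)
    (hB₀' : 0 < B₀') (hB : 2 ≤ 5 * (d : ℝ) * L * B₀) (hC₂ : 2097152 * ((d : ℝ) + 1) ^ 2 * (L : ℝ) ^ 2 ≤ C₂) (hcB9 : 0 < cB9)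
    (hB₀'H : 0 < B₀'H) (hB₂' : 0 ≤ B₂') (hBG : 0 ≤ BG) (hBR : 0 ≤ BR) (hfree : 3 * (2 * (d : ℝ) * (L : ℝ) ^ 2) * BG * BR ≤ B₀')
    (hBbd : 0 ≤ Bbd) (hBd : 4 * Bbd ≤ ((d : ℝ) * L - 1) * B₀) :
    ∃ c₁ : ℝ, 0 < c₁ ∧ ∀ (η : ℝ), 0 < η → ∀ {K : ℕ} {Ω : ℕ → Set (Site d)} (c : CubeB8D d L K Ω),
      -- (1.59) for `G(1)`, `H(1)` IN THE REPAIRED CURRENCY: the FOUR-LINE Prop.-3-frame socket at background `1` on the cube, collar term on each line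
      (∀ α₀' α₂ : ℝ, 0 < α₀' → α₀' ≤ cB9 → 0 < α₂ → α₂ ≤ cB9 →
        ∀ (W : Site d → Fin d → 𝔸ˣ), (∀ x κ, W x κ ∈ unitaryUnits 𝔸) →
        InAk L c.k η α₀' c.sq (1 : Site d → Fin d → 𝔸ˣ) → InAk L c.k η α₀' c.sq (mulCfg W (1 : Site d → Fin d → 𝔸ˣ)) →
        IsLandau138W L c.k η (c.sq 0) c.lamS (1 : Site d → Fin d → 𝔸ˣ) W →
        ∀ A' : Site d → Fin d → 𝔸, (∀ y τ, IsSelfAdjoint (A' y τ)) →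
        (∀ j, j ≤ c.k → ∀ (y : Site d) (τ : Fin d), SideTouches (c.sq j) y τ →
          W y τ = cfgExp η A' y τ ∧ ‖A' y τ‖ ≤ α₂ * ((L : ℝ) ^ j * η)⁻¹) →
        (∀ (y : Site d) (τ : Fin d), (∀ j, j ≤ c.k → ¬ SideTouches (c.sq j) y τ) → A' y τ = 0) →
        msup L c.k η (-(1 : ℝ)) (fun j (b : Site d × Fin d) => SideTouches (c.sq j) b.1 b.2) (fun b => A' b.1 b.2)
            ≤ B₀ * (bondNorm L c.k η (-(3 : ℝ)) c.sq (fun x μ => Jcur η (1 : Site d → Fin d → 𝔸ˣ) A' μ x)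
              + wsup 1 (fun p : {p : ℕ × (Site d × Fin d) // p.1 ≤ c.k ∧ (p.2 ∈ c.lamBPT c.k p.1 ∨ (p.1 = 0 ∧ CrossB (c.sq 0) p.2))} =>
                  linCovIter L (1 : Site d → Fin d → 𝔸ˣ) (iEta η A') p.1.1 p.1.2.1 p.1.2.2))
              + Bbd * msup L c.k η (-(1 : ℝ)) (fun j (b : Site d × Fin d) => j = 0 ∧ SideTouches (c.sq 0) b.1 b.2 ∧
                  ¬ BondTouches (c.sq 0) b.1 b.2) (fun b => A' b.1 b.2) ∧
          msup L c.k η (-(2 : ℝ)) (fun j (t : Fin d × Fin d × Site d) => SideTouches (c.sq j) t.2.2 t.2.1)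
              (fun t => covDerivFwd η (1 : Site d → Fin d → 𝔸ˣ) t.1 (fun z => A' z t.2.1) t.2.2)
            ≤ B₀ * (bondNorm L c.k η (-(3 : ℝ)) c.sq (fun x μ => Jcur η (1 : Site d → Fin d → 𝔸ˣ) A' μ x)
              + wsup 1 (fun p : {p : ℕ × (Site d × Fin d) // p.1 ≤ c.k ∧ (p.2 ∈ c.lamBPT c.k p.1 ∨ (p.1 = 0 ∧ CrossB (c.sq 0) p.2))} =>
                  linCovIter L (1 : Site d → Fin d → 𝔸ˣ) (iEta η A') p.1.1 p.1.2.1 p.1.2.2))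
              + Bbd * msup L c.k η (-(1 : ℝ)) (fun j (b : Site d × Fin d) => j = 0 ∧ SideTouches (c.sq 0) b.1 b.2 ∧
                  ¬ BondTouches (c.sq 0) b.1 b.2) (fun b => A' b.1 b.2) ∧
          bondNorm L c.k η (-(3 : ℝ)) c.sq (fun x μ => pdiv η (1 : Site d → Fin d → 𝔸ˣ) (plaqCovDeriv η (1 : Site d → Fin d → 𝔸ˣ) A') μ x)
            ≤ B₀ * (bondNorm L c.k η (-(3 : ℝ)) c.sq (fun x μ => Jcur η (1 : Site d → Fin d → 𝔸ˣ) A' μ x)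
              + wsup 1 (fun p : {p : ℕ × (Site d × Fin d) // p.1 ≤ c.k ∧ (p.2 ∈ c.lamBPT c.k p.1 ∨ (p.1 = 0 ∧ CrossB (c.sq 0) p.2))} =>
                  linCovIter L (1 : Site d → Fin d → 𝔸ˣ) (iEta η A') p.1.1 p.1.2.1 p.1.2.2))
              + Bbd * msup L c.k η (-(1 : ℝ)) (fun j (b : Site d × Fin d) => j = 0 ∧ SideTouches (c.sq 0) b.1 b.2 ∧
                  ¬ BondTouches (c.sq 0) b.1 b.2) (fun b => A' b.1 b.2) ∧
          bondNorm L c.k η (-(3 : ℝ)) c.sq (fun x μ => covLap η (1 : Site d → Fin d → 𝔸ˣ) (fun z => A' z μ) x)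
            ≤ B₀ * (bondNorm L c.k η (-(3 : ℝ)) c.sq (fun x μ => Jcur η (1 : Site d → Fin d → 𝔸ˣ) A' μ x)
              + wsup 1 (fun p : {p : ℕ × (Site d × Fin d) // p.1 ≤ c.k ∧ (p.2 ∈ c.lamBPT c.k p.1 ∨ (p.1 = 0 ∧ CrossB (c.sq 0) p.2))} =>
                  linCovIter L (1 : Site d → Fin d → 𝔸ˣ) (iEta η A') p.1.1 p.1.2.1 p.1.2.2))
              + Bbd * msup L c.k η (-(1 : ℝ)) (fun j (b : Site d × Fin d) => j = 0 ∧ SideTouches (c.sq 0) b.1 b.2 ∧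
                  ¬ BondTouches (c.sq 0) b.1 b.2) (fun b => A' b.1 b.2)) →
      ∀ (U₀ : Site d → Fin d → 𝔸ˣ), (∀ x κ, U₀ x κ ∈ unitaryUnits 𝔸) → ∀ (α₀ : ℝ), 0 < α₀ → InAk L K η α₀ Ω U₀ →
      7 * d * (L : ℝ) ^ 2 * c.M * α₀ ≤ c₁ →
      -- the weights of `Q′ᵀwQ′` and THE THREE REAL INEQUALITY FAMILIES on the explicit matrices at every truncation `n ≤ k`
      ∀ (w : ℕ → ℝ), (∀ j, 0 ≤ w j) →
      (∀ n, 1 ≤ n → n ≤ c.k → ∀ (S : Finset (Site d)), (∀ x, x ∈ S ↔ x ∈ c.sq 0) →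
        ∀ (B : Finset (ℕ × Site d)), (∀ p, p ∈ B ↔ p.1 ≤ n ∧ p.2 ∈ c.lamST n p.1) →
        ∀ (K : Site d → Site d → ℝ), (∀ x z, K x z =
          ((η ^ 2)⁻¹ * ∑ μ : Fin d, ((2 : ℝ) * (if z = x then (1 : ℝ) else 0) - (if z = x + e μ then (1 : ℝ) else 0)
            - (if z = x - e μ then (1 : ℝ) else 0))) +
          (∑ j ∈ Finset.range (n + 1), (if blockMap (L ^ j) x ∈ c.lamST n j ∧ blockMap (L ^ j) z = blockMap (L ^ j) x then
            w j * ((((L : ℝ) ^ d)⁻¹) ^ j) ^ 2 else 0))) →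
        ∀ (T : Matrix ↥S ↥S ℝ), T = Matrix.of (fun x z : ↥S => K x.1 z.1) →
        ∀ (Q : Matrix ↥B ↥S ℝ), Q = Matrix.of (fun (p : ↥B) (z : ↥S) =>
          if blockMap (L ^ p.1.1) z.1 = p.1.2 then (((L : ℝ) ^ d)⁻¹) ^ p.1.1 else 0) →
        (∀ (ρ' : ↥S → ℝ) (r : ℝ), 0 ≤ r →
          (∀ j, j ≤ n → ∀ z : ↥S, z.1 ∈ c.sq j → wt L η j ^ 2 * |ρ' z| ≤ r) →
          ∀ φ : Site d → ℝ, (∀ x, x ∉ c.sq 0 → φ x = 0) → (∀ v : ↥S, φ v.1 = ∑ z : ↥S, T⁻¹ v z * ρ' z) →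
          (∀ x, |φ x| ≤ BG * r) ∧
          ∀ j, j ≤ n → ∀ p ∈ {b : Site d × Fin d | SideTouches (c.sq j) b.1 b.2},
            wt L η j * |η⁻¹ * (φ (p.1 + e p.2) - φ p.1)| ≤ BG * r) ∧
        (∀ (X : ↥B → ℝ) (s : ℝ), 0 ≤ s → (∀ p', |X p'| ≤ s) →
          ∀ φ : Site d → ℝ, (∀ x, x ∉ c.sq 0 → φ x = 0) →
          (∀ v : ↥S, φ v.1 = ∑ p' : ↥B, (T⁻¹ * (T⁻¹ * Qᵀ) * (Q * T⁻¹ * T⁻¹ * Qᵀ)⁻¹) v p' * X p') →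
          (∀ x, |φ x| ≤ B₀'H * s) ∧
          (∀ j, j ≤ n → ∀ p ∈ {b : Site d × Fin d | SideTouches (c.sq j) b.1 b.2},
            wt L η j * |η⁻¹ * (φ (p.1 + e p.2) - φ p.1)| ≤ B₀'H * s) ∧
          (∀ j, j ≤ n → ∀ x ∈ c.sq j,
            wt L η j ^ 2 * |∑ μ : Fin d, (η ^ 2)⁻¹ * (2 * φ x - φ (x + e μ) - φ (x - e μ))| ≤ B₂' * s)) ∧
        (∀ (ρ' : ↥S → ℝ) (r : ℝ), 0 ≤ r →
          (∀ j, j ≤ n → ∀ z : ↥S, z.1 ∈ c.sq j → wt L η j ^ 2 * |ρ' z| ≤ r) →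
          ∀ j, j ≤ n → ∀ v : ↥S, v.1 ∈ c.sq j →
            wt L η j ^ 2 * |ρ' v - ∑ z : ↥S, (T⁻¹ * (Qᵀ * ((Q * T⁻¹ * T⁻¹ * Qᵀ)⁻¹ * (Q * T⁻¹)))) v z * ρ' z| ≤ BR * r)) →
      -- (1.59) for `G(1)` IN THE REPAIRED CURRENCY: Theorem 4's two-member clause at background `1`, support clause + collar allowance (`H59D₁`)
      ((∀ m, 1 ≤ m → m ≤ c.k → ∀ (u : Site d → 𝔸ˣ) (W : Site d → Fin d → 𝔸ˣ) (A' : Site d → Fin d → 𝔸),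
        (∀ x, u x ∈ unitaryUnits 𝔸) → (∀ x, x ∉ c.sq 0 → u x = 1) →
          mgauge (1 : Site d → Fin d → 𝔸ˣ) u W = (cutFixed L (tLo c.a c.ρ) (tHi c.a c.M c.ρ) U₀ c.k (ctr c.a c.M)) →
          Restr129 L m (c.lamST m) (1 : Site d → Fin d → 𝔸ˣ) u →
          IsLandau138W L m η (c.sq 0) (c.lamST m) (1 : Site d → Fin d → 𝔸ˣ) W →
        (∀ y τ, IsSelfAdjoint (A' y τ)) →
        (∀ j, j ≤ m → ∀ y τ, SideTouches (c.sq j) y τ →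
        W y τ = cfgExp η A' y τ ∧
          ‖A' y τ‖ ≤ (2 * (L * (5 * (d : ℝ) * L * B₀ * (((L : ℝ) ^ 3 * α₀) + (6 * d * (L : ℝ) ^ 2 * c.M * α₀)))) + 8 * (8 * B₀' * (5 * (d : ℝ) * L * B₀) * (((L : ℝ) ^ 3 * α₀) + (6 * d * (L : ℝ) ^ 2 * c.M * α₀)))) * ((L : ℝ) ^ j * η)⁻¹) →
        (∀ y τ, (∀ j, j ≤ m → ¬ SideTouches (c.sq j) y τ) → A' y τ = 0) →
        msup L m η (-(1 : ℝ)) (fun j (b : Site d × Fin d) => SideTouches (c.sq j) b.1 b.2) (fun b => A' b.1 b.2)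
        ≤ B₀ * (bondNorm L m η (-(3 : ℝ)) c.sq (fun x μ => Jcur η (1 : Site d → Fin d → 𝔸ˣ) A' μ x)
        + wsup 1 (fun p : {p : ℕ × (Site d × Fin d) // p.1 ≤ m ∧ (p.2 ∈ c.lamBPT m p.1 ∨ (p.1 = 0 ∧ CrossB (c.sq 0) p.2))} =>
        linCovIter L (1 : Site d → Fin d → 𝔸ˣ) (iEta η A') p.1.1 p.1.2.1 p.1.2.2))
        + Bbd * msup L m η (-(1 : ℝ)) (fun j (b : Site d × Fin d) => j = 0 ∧ SideTouches (c.sq 0) b.1 b.2 ∧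
            ¬ BondTouches (c.sq 0) b.1 b.2) (fun b => A' b.1 b.2) ∧
        msup L m η (-(2 : ℝ)) (fun j (t : Fin d × Fin d × Site d) => SideTouches (c.sq j) t.2.2 t.2.1)
        (fun t => covDerivFwd η (1 : Site d → Fin d → 𝔸ˣ) t.1 (fun z => A' z t.2.1) t.2.2)
        ≤ B₀ * (bondNorm L m η (-(3 : ℝ)) c.sq (fun x μ => Jcur η (1 : Site d → Fin d → 𝔸ˣ) A' μ x)
        + wsup 1 (fun p : {p : ℕ × (Site d × Fin d) // p.1 ≤ m ∧ (p.2 ∈ c.lamBPT m p.1 ∨ (p.1 = 0 ∧ CrossB (c.sq 0) p.2))} =>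
        linCovIter L (1 : Site d → Fin d → 𝔸ˣ) (iEta η A') p.1.1 p.1.2.1 p.1.2.2))
        + Bbd * msup L m η (-(1 : ℝ)) (fun j (b : Site d × Fin d) => j = 0 ∧ SideTouches (c.sq 0) b.1 b.2 ∧
            ¬ BondTouches (c.sq 0) b.1 b.2) (fun b => A' b.1 b.2))) →
      GaugedBoundB8D L η U₀ c (7 * d * (L : ℝ) ^ 2 * (5 * (d : ℝ) * L * B₀) * c.M * α₀) := by
  have hL1 : 1 ≤ L := le_trans (by norm_num) hL
  have hd1 : 1 ≤ d := le_trans (by norm_num) hd2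
  have hLpos : (0 : ℝ) < L := by exact_mod_cast hL1
  have hdpos : (0 : ℝ) < d := by exact_mod_cast hd1
  have hC₂0 : 0 ≤ C₂ := le_trans (by positivity) hC₂
  obtain ⟨c₄, hc₄, H4⟩ := prop6_dentedMember_flat_of_real_γ (𝔸 := 𝔸) hd2 hL hB₀ hB₀' hB hB₀'H hB₂' hBG hBR hfree hBbd hBd
  obtain ⟨c₃, hc₃, N3⟩ := norms136_dentedMember_flat_γ_d4 (𝔸 := 𝔸) hd2 hL hB₀ hC₂ hcB9 hBbd hBd
  obtain ⟨cW, hcW, W⟩ := windows136_of_small hd2 hL hB₀ hC₂0 hc₃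
  set B : ℝ := 5 * (d : ℝ) * L * B₀ with hB_def
  have hB0 : 0 < B := by positivity
  set C : ℝ := 131072 * ((d : ℝ) + 1) ^ 2 with hC_def
  have hC0 : 0 < C := by positivity
  refine ⟨min c₄ (min cW (1 / (16 * C * B))), lt_min hc₄ (lt_min hcW (by positivity)), ?_⟩
  intro η hη K Ω c SB9 U₀ hU₀ α₀ hα hAK hs w hw REAL H59
  -- the cube's laws as datum binders
  have hk : 1 ≤ c.k := c.one_le_k
  have hρL : L ≤ c.ρ := c.L_le_ρ
  have hρM : c.ρ ≤ c.M := c.ρ_le_M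
  have hρ : 1 ≤ c.ρ := hL1.trans hρL
  have hM1 : 1 ≤ c.M := hρ.trans hρM
  have hM : 11 * (d : ℝ) < c.M := by exact_mod_cast c.big
  have hLdM : (L : ℝ) ≤ d * c.M := by exact_mod_cast c.L_le_dM
  have hA : InAk L c.k η α₀ Ω U₀ := c.inAk hAK
  have hs₄ : 7 * d * (L : ℝ) ^ 2 * c.M * α₀ ≤ c₄ := hs.trans (min_le_left _ _)
  have hsW : 7 * d * (L : ℝ) ^ 2 * c.M * α₀ ≤ cW := hs.trans ((min_le_right _ _).trans (min_le_left _ _))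
  have hsC : 7 * d * (L : ℝ) ^ 2 * c.M * α₀ ≤ 1 / (16 * C * B) := hs.trans ((min_le_right _ _).trans (min_le_right _ _))
  -- every window from «7dL²Mα₀ ≤ c₁»
  obtain ⟨⟨hα3, hα2, hsmall⟩, ⟨hα₀c, hα₁c, hα₂c⟩, h61, ⟨-, -, h16, -, hc3α, hsmall₁⟩, h12⟩ := W c.M c.ρ hM1 hρM hM hLdM α₀ hα hsW
  -- PROPOSITION 6's existence half at the member FROM THE REAL FAMILIES + `H59D₁` (this seat's `B8Prop6CubeMemberFlatScalarBdry`)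
  obtain ⟨u, hu, huS, h129, hLan, h162, hw', h135⟩ := H4 η hη c U₀ hU₀ α₀ hα hα3 hα2 hA
    hsmall (smallness_134 hLpos hα hLdM hs₄) w hw REAL H59
  -- PROPOSITION 3's norm members at the member FROM THE FOUR-LINE FLAT SOCKET (this seat's `B8Prop6CubeMemberNormsFlatBdry4`)
  obtain ⟨h136g, h139j, h139l⟩ := N3 η hη c SB9 U₀ hU₀ α₀ hα hα3 hα2 hA hsmall hα₀c hα₂c
    h61 hsmall₁ u hu huS h129 hLan h162
  -- the three norm members of (1.136), with print's constant (`const_136`)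
  have hconst : B * ((L : ℝ) ^ 3 * α₀ + 6 * d * (L : ℝ) ^ 2 * c.M * α₀) ≤ 7 * d * (L : ℝ) ^ 2 * B * c.M * α₀ :=
    const_136 hLpos hα hB0.le hLdM
  have h136₂ := h136g.trans hconst
  have h136₃ := h139j.trans hconst
  have h136₄ := h139l.trans hconst
  have h16C : 16 * (131072 * ((d : ℝ) + 1) ^ 2) * (B * ((L : ℝ) ^ 3 * α₀ + 6 * d * (L : ℝ) ^ 2 * c.M * α₀)) ≤ 1 := by
    have e1 : B * ((L : ℝ) ^ 3 * α₀ + 6 * d * (L : ℝ) ^ 2 * c.M * α₀) ≤ 7 * d * (L : ℝ) ^ 2 * B * c.M * α₀ := hconst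
    have e3 : B * (7 * d * (L : ℝ) ^ 2 * c.M * α₀) ≤ B * (1 / (16 * C * B)) := mul_le_mul_of_nonneg_left hsC hB0.le
    have e4 : B * (1 / (16 * C * B)) = 1 / (16 * C) := by field_simp
    have e2 : 7 * d * (L : ℝ) ^ 2 * B * c.M * α₀ = B * (7 * d * (L : ℝ) ^ 2 * c.M * α₀) := by ring
    have e5 : B * ((L : ℝ) ^ 3 * α₀ + 6 * d * (L : ℝ) ^ 2 * c.M * α₀) ≤ 1 / (16 * C) := by linarith [e1, e3]
    calc 16 * (131072 * ((d : ℝ) + 1) ^ 2) * (B * ((L : ℝ) ^ 3 * α₀ + 6 * d * (L : ℝ) ^ 2 * c.M * α₀))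
        ≤ 16 * C * (1 / (16 * C)) := mul_le_mul_of_nonneg_left e5 (by positivity)
      _ = 1 := by field_simp
  exact gaugedBoundB8D_of_clauses hd2 hL hB₀ hη c U₀ hU₀ hα hA hα3 hα2 hsmall h16C hc3α u hu huS h129 hLan h162 hw' h135
    h136₂ h136₃ h136₄

#print axioms gaugedBoundB8D_dentedMember_real_γ


end Literature.MathematicalPhysics.QuantumFieldTheory.Balaban1983to89.B8Prop6DentedCubeMemberGaugedRealGamma

end
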